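import Summits.QuantumFields.YangMills.Theorems.BalabanUVNodesN07ChartDLocality
import Summits.QuantumFields.YangMills.Theorems.BalabanUVNodesN07ChartDDerivative
import Summits.QuantumFields.YangMills.Theorems.BalabanUVNodesN07ChartDOfRecord
import HarnessLib

/-!
# BalabanUVNodes ∕ N07 — [15] PROPOSITION 3's (73) WITH DECAY FOR THE TRUE MULTI-LEVEL (0.4)-CONSTRAINT: the functional derivative `𝔇 = δD(A′)∕δA′` of the chart (47)
# in WEIGHT-CONJUGATION (Combes–Thomas) form — «the formula (70) and the inequalities (71), (72) give finally (73)» with the LOCALITY of `C_j` and a decay letter of `H`,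
# generic carrier `P : Params` (⇒ NODE 00's T⁴ tori)

Cell `pub-ymgap`, width seat `pub-ymgap-dag-n07-w2` generation 4 (HUMAN RULING D-0149; DAG node N07 = [15] = [Balaban1985Variational]; W-SEAT START LIST §n07 item 2 = S2
«[15] Sect. C (47)–(49), Prop. 3 at objects» — the last printed clause, generation 3's honest remainder «(73) WITH KERNEL DECAY»).  `--kind proof --supports
stmt-QuantumFields-20542 --as helper` (K1⁷; count-neutral).  Part 2 of 2; part 1 = `…N07ChartDLocality` (§1 locality of the derivative ∕ read sets, §1b (72) localised,
§2 the derivative's fixed-point identity).  CONSUMED BY NAME, nothing modified: part 1's `N07ChartDLocality.{norm_fderiv_chartC_apply_le_reads, chartD_fderiv_eq}`, generation 3's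
`N07ChartDDerivative.exists_chartD_hasFDerivAt` (the chart map `D(·)` with (55), (49), (48), a Fréchet derivative, (73) at norm level), `N07ChartDOfRecord.size_chartA_le` ((57)),
the route `UnitScaleTilt`'s `Prop8Chart.{chartLog, collar_of_adm22}`, dag k0-s1-w3's `K0FlatCubeOpsTextP.{IsLevWeight, levWeight_nonneg}`.

THE PRINT ([15] pp. 288–289): «Let us denote by 𝔇(A′) the kernel of the derivative (δ∕δA′)D(A′) … (I + ℜ)𝔇(A′) = Lʲη(δ∕δA)C … (68) … Equation (68) is uniquely solvable by a
convergent Neumann series, 𝔇(A′) = (I + ℜ)⁻¹Lʲη(δ∕δA)C(A′ − HD(A′)) (70) … A kernel of the operator (I + ℜ)⁻¹ satisfies the bound |(I + ℜ)⁻¹(c, c′)| ≤ … ≤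
2(L^{j′}η)^{−d}e^{−½δ₀d(c₋,c′₋)} (71) for ε₃ sufficiently small, which follows from Lemma 2.1 [3].  Proposition 5 of [4] implies that |Lʲη(δC_j∕δA)(Lʲη(A′ − HD(A′)))| ≤
Lʲη(Lʲη)^{−d}C₃2ε₃ (72) … The formula (70) and the inequalities (71), (72) give finally the following inequality |𝔇(A′; c, b)| ≤ O(1)C₃ε₃(Lʲη)^{−d+1}e^{−½δ₀d(c₋,y)},
b ∈ Bʲ(y), y ∈ Λ_j (73)», and (69) p. 288 «sup_{b ⊂ Bʲ(c₋)∪Bʲ(c₊)}» — the functional `C_j(·, c)` reads the field only under the two blocks of `c`.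

THE READING (no kernels).  Exponential decay of a kernel `|K(c, b)| ≲ e^{−δd(c,b)}` on a finite index set is the boundedness of the operator in every exponentially TWISTED
sup-norm `sup_c e(c)‖(KW)(c)‖ ≤ const·sup_b e(b)‖W(b)‖` with `e = e^{±δ·dist(·, y)}`.  This file proves (73) in that form, for ARBITRARY positive twists `eE` (fine bonds),
`eF` (index bonds) that are READ-COMPATIBLE — `eF(j,c) ≤ κ·eE(b)` whenever `b` is read by `(j,c)` (§1: by `chartLog_congr` the read set of `(j,c)` is `{b : Bʲ(b₋), Bʲ(b₊) ∈
{c₋, c₊}}`) — and for `H` carrying the TWISTED (46) letter `eE(b)·w₁(b)‖HX(b)‖ ≤ B_e·sup_c eF(c)‖X(c)‖`, DISPLAYED (generation 3 displayed hH in its file 6 the same way; §4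
derives it for exponential twists from a KERNEL-DECAY letter of `H` — the matrix form of P2's `HDecayLetterD`, first row — plus the triangle inequality and the row sum `c₁`
of [3] Lemma 2.1, which is where print's `d·c₁(½)` enters the window «18C₂B₀dc₁(½)ε₃ ≤ 1»).

WHAT IS PROVED (sorry-free; no definition; axioms standard; matrix fibre `M_n(ℂ)` as in generation 3's files 6–7).
§3 ★★★ `chartD_fderiv_twisted_le` — (73) IN WEIGHT-CONJUGATION FORM: under the twisted letter `B_e` and `4C₃κB_eε ≤ 1` (`C₃ = 3840ℓL∕R⋆`, `R⋆ = 1∕(12800ℓ²L)`,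
`ℓ = (d+2)L`; `16ε ≤ R⋆`; chart point of size `≤ 2ε`): `eF(j,c)·‖𝔇W (j,c)‖ ≤ 4C₃κε·t` whenever `eE(b)·w₁(b)‖W b‖ ≤ t` — the print's three lines: part 1 §2 ((70)),
part 1 §1b ((72) with locality), the twisted letter, and the finite maximum `m ≤ 2C₃κεt + ½m` ((71)'s Neumann majorant `(1 − q)⁻¹ ≤ 2`).
§4 `twistedLetter_of_kernelDecay` (kernel-decay letter of `H` at rate `δ₀` + triangle inequality + row sum `Σ_c e^{−(δ₀−δ)d(b,c)} ≤ c₁` ⇒ the twisted letter `B₀c₁` for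
the twists `e^{δ·dE}`, `e^{δ·dF}`); ★★★ `chartD_fderiv_decay` — (73) IN PRINT's SHAPE: for `W` supported where `dE ≤ r` with `w₁(b)‖W b‖ ≤ t`,
`‖𝔇W (j,c)‖ ≤ 4C₃e^{δr₀}ε·e^{δr}·t·e^{−δ·dF(j,c)}` (read-locality `dF(j,c) ≤ dE(b) + r₀`, window `4C₃e^{δr₀}B₀c₁ε ≤ 1`).
§5 ★★★ `exists_chartD_hasFDerivAt_twisted` — PACKAGED WITH GENERATION 3's SELECTOR: g3's `exists_chartD_hasFDerivAt` conjuncts ∧ the twisted (73) for the same `𝔇` (the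
size `≤ 2ε` of the chart point is (57) with (55) and `18C₂B₀ε ≤ 1`); `twistedLetter_one_of_supLetter` (A6, consistency of the binder block, DEGENERATE witness: at the
trivial twist the displayed hypotheses ARE g3's plain (46) letter, and §3 returns g3's `4C₃ε`); `exists_eps_twisted` (A6: the joint `ε`-window is inhabited).

HONEST FRAMING: count-neutral helper; compositions of kernel theorems by name + finite-sum bookkeeping; the twisted ∕ kernel-decay (46) letter of the record's `H` is
DISPLAYED, NOT discharged here — for the route's corrected right inverse `HX = H₀X̃′ + dφ` (`ChartHInv.exists_rightInverse`, consumed at the record by dag k0-s1-w1's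
`exists_rightInverse_chartLog_of_flatH`) its discharge is P2's `HDecayLetterD` for `H₀` plus the locality of the comb ∕ tent correction, a separate piece; the scalar
prefactor `(Lʲη)^{−d+1}` of (73) is the weights' bookkeeping (`w₁`, lit-balaban `B11Eq73KernelDecay.ineq73_printed`'s `hscale`), not re-derived; (58) and [15] Sects. D–F
NOT here; stub 1 ∕ K0⁷ ∕ K1⁷ NOT closed; N07 NOT discharged; counts unmoved; one finite T⁴ programme at fixed ε — NOT continuum ∕ ℝ⁴ ∕ OS ∕ mass gap ∕ Clay: the
Yang–Mills mass gap is NOT proved by any of this; R4 closes the conditional rung `BalabanLadder.UV` only.  No `sorry`, no `def`, no `instance`, no `notation`.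

References: [15] T. Bałaban, CMP 102 (1985) 277–309 [Balaban1985Variational] ((43)–(57) pp.285–287, (63)–(73) pp.287–289, Prop. 3 p.289, (156)–(157) p.302); [3] = [B6]
CMP 96 (1984) 223–250 [Balaban1984PropagatorsII] (Lemma 2.1 p.232, (2.54) p.233); [4] = [B7] CMP 98 (1985) 17–51 [Balaban1985Averaging] (Prop. 5 (156)–(157) p.42);
[I] CMP 109 (1987) 249–301 [Balaban1987RG1] ((0.4) p.253).
-/

noncomputable section

open scoped BigOperators Matrix.Norms.L2Operator
open NormedSpace Metric Set Filter Topology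

namespace Summit.QuantumFields.YangMills.BalabanUVNodes.N07ChartDDecay

open Literature.MathematicalPhysics.QuantumFieldTheory.Balaban1983to89
open Literature.MathematicalPhysics.QuantumFieldTheory.Balaban1983to89.B6SectADomainsV1 (Domains)
open Literature.MathematicalPhysics.QuantumFieldTheory.Balaban1983to89.B6SectAOperatorsV1 (BondIdx)
open Literature.MathematicalPhysics.QuantumFieldTheory.Balaban1983to89.B5Eq118OneStroke (iterBlockOf)
open Summit.QuantumFields.YangMills.Theorems.FlatCubeOpsText (Adm22)
open Summit.QuantumFields.YangMills.Theorems.K0FlatCubeOpsTextP (IsLevWeight levWeight_nonneg)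
open Summit.QuantumFields.YangMills.Theorems.Prop8Chart (chartLog collar_of_adm22)
open Summit.QuantumFields.YangMills.BalabanUVNodes.N07ChartDOfRecord (size_chartA_le)
open Summit.QuantumFields.YangMills.BalabanUVNodes.N07ChartDDerivative (exists_chartD_hasFDerivAt)
open Summit.QuantumFields.YangMills.BalabanUVNodes.N07ChartDLocality (norm_fderiv_chartC_apply_le_reads chartD_fderiv_eq)

variable {P : Params}

/-! ## §3  (73) IN WEIGHT-CONJUGATION FORM: the derivative of the chart is bounded in EVERY read-compatible twisted weighted sup-norm in which `H` is -/

section Twisted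

variable {n : Type*} [Fintype n] [DecidableEq n] [Nonempty n]

/-- ★★★ **[15] (73) WITH DECAY, WEIGHT-CONJUGATION (COMBES–THOMAS) FORM — «the formula (70) and the inequalities (71), (72) give finally (73)».**  Data: a nested
family `D` (`D.k = k`) with the collar property, the level weights `w` (`K0FlatCubeOpsTextP.IsLevWeight`), ANY ℂ-linear `H`, ANY selector `Dfun` solving (49) on the open
weighted `ε`-ball (`16ε ≤ R⋆ := 1∕(12800ℓ²L)`, `ℓ = (d+2)L`), a point `A′` of the ball whose chart point `X₀ = A′ − H·Dfun A′` has weighted size `≤ 2ε` ((57)), and a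
Fréchet derivative `𝔇` of `Dfun` at `A′`.  TWISTS: positive `eE` on the fine bonds and `eF` on the index bonds, READ-COMPATIBLE (`eF(j,c) ≤ κ·eE(b)` whenever `b` is
read by `(j,c)`), and the TWISTED (46) letter of `H`: `eE(b)·w₁(b)·‖HX(b)‖ ≤ B_e·sup_c eF(c)‖X(c)‖` (DISPLAYED).  Under `4C₃κB_eε ≤ 1` (`C₃ = 3840ℓL∕R⋆`; print's
«18C₂B₀dc₁(½)ε₃ ≤ 1»): for every direction `W` with `eE(b)·w₁(b)‖W b‖ ≤ t`, **`eF(j,c)·‖𝔇W (j,c)‖ ≤ 4C₃κε·t`** at every index.  PROOF = the print's three lines in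
operator-conjugation form: §2's identity `𝔇 = 𝒞′W − 𝒞′H𝔇W` ((70) as «(I + ℜ)𝔇 = 𝒞′»), §1b's localised (72) (`eF·‖𝒞′V‖ ≤ 2C₃κε·(twisted size of V)`), the twisted
letter of `H` ((71)'s input), and the finite maximum `m = max_c eF(c)‖𝔇W(c)‖ ≤ 2C₃κεt + ½m` ((71): the Neumann majorant `(1 − q)⁻¹ ≤ 2`).  With `eE ≡ eF ≡ 1`,
`κ = 1` this is the norm-level (73) of `N07ChartDDerivative`; with exponential twists it is the kernel decay of (73) (§4).
[cite: Balaban1985Variational, (68)-(73) pp.288-289, Prop. 3 p.289; Balaban1984PropagatorsII, Lemma 2.1 p.232] -/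
theorem chartD_fderiv_twisted_le (k : ℕ) (D : Domains P) (hDk : D.k = k)
    (hcollar : ∀ (i : ℕ) (e : PBond P (i + 1)), D.LamBond (i + 1) e → ∀ z : Site P i, (blockOf z = e.src ∨ blockOf z = e.tgt) → z ∈ D.Om i)
    {w : ℕ → PBond P 0 → ℝ} (hw : IsLevWeight P k D w)
    (H : (BondIdx D → Matrix n n ℂ) →ₗ[ℂ] (PBond P 0 → Matrix n n ℂ)) {ε : ℝ} (hε : 0 < ε)
    (h16 : 16 * ε ≤ (12800 * (((P.d + 2) * P.L : ℕ) : ℝ) ^ 2 * (P.L : ℝ))⁻¹)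
    (Dfun : (PBond P 0 → Matrix n n ℂ) → (BondIdx D → Matrix n n ℂ))
    (h49 : ∀ A : PBond P 0 → Matrix n n ℂ, (∀ b, w 1 b * ‖A b‖ < ε) →
      chartLog (((P.L : ℝ)⁻¹) ^ k) D (A - H (Dfun A)) -
          (fderiv ℂ (chartLog (((P.L : ℝ)⁻¹) ^ k) D : (PBond P 0 → Matrix n n ℂ) → BondIdx D → Matrix n n ℂ) 0) (A - H (Dfun A)) = Dfun A)
    {A' : PBond P 0 → Matrix n n ℂ} (hA' : ∀ b, w 1 b * ‖A' b‖ < ε) (hX₀ : ∀ b, w 1 b * ‖(A' - H (Dfun A')) b‖ ≤ 2 * ε)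
    {𝔇 : (PBond P 0 → Matrix n n ℂ) →L[ℂ] (BondIdx D → Matrix n n ℂ)} (h𝔇 : HasFDerivAt Dfun 𝔇 A')
    (eE : PBond P 0 → ℝ) (eF : BondIdx D → ℝ) (heE : ∀ b, 0 < eE b) (heF : ∀ i, 0 < eF i) {κ : ℝ} (hκ0 : 0 ≤ κ)
    (hκ : ∀ (idx : BondIdx D) (b : PBond P 0),
      (iterBlockOf (idx.1.1 : ℕ) b.src = idx.1.2.src ∨ iterBlockOf (idx.1.1 : ℕ) b.src = idx.1.2.tgt) →
      (iterBlockOf (idx.1.1 : ℕ) b.tgt = idx.1.2.src ∨ iterBlockOf (idx.1.1 : ℕ) b.tgt = idx.1.2.tgt) → eF idx ≤ κ * eE b)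
    {Be : ℝ} (hBe : 0 ≤ Be)
    (hHe : ∀ (X : BondIdx D → Matrix n n ℂ) (t : ℝ), 0 ≤ t → (∀ i, eF i * ‖X i‖ ≤ t) → ∀ b, eE b * (w 1 b * ‖H X b‖) ≤ Be * t)
    (hsmall : 4 * (3840 * (((P.d + 2) * P.L : ℕ) : ℝ) * (P.L : ℝ) / (12800 * (((P.d + 2) * P.L : ℕ) : ℝ) ^ 2 * (P.L : ℝ))⁻¹) * κ * Be * ε ≤ 1)
    (W : PBond P 0 → Matrix n n ℂ) (t : ℝ) (ht : 0 ≤ t) (hW : ∀ b, eE b * (w 1 b * ‖W b‖) ≤ t) (i : BondIdx D) :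
    eF i * ‖𝔇 W i‖ ≤ 4 * (3840 * (((P.d + 2) * P.L : ℕ) : ℝ) * (P.L : ℝ) / (12800 * (((P.d + 2) * P.L : ℕ) : ℝ) ^ 2 * (P.L : ℝ))⁻¹) * κ * ε * t := by
  -- the letters
  set Rs : ℝ := (12800 * (((P.d + 2) * P.L : ℕ) : ℝ) ^ 2 * (P.L : ℝ))⁻¹ with hRsdef
  set C₃ : ℝ := 3840 * (((P.d + 2) * P.L : ℕ) : ℝ) * (P.L : ℝ) / Rs with hC₃def
  set cL := (chartLog (((P.L : ℝ)⁻¹) ^ k) D : (PBond P 0 → Matrix n n ℂ) → BondIdx D → Matrix n n ℂ) with hcLdef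
  have hL0 : (0 : ℝ) < P.L := by exact_mod_cast P.L_pos
  have hℓ1 : (1 : ℝ) ≤ (((P.d + 2) * P.L : ℕ) : ℝ) := by
    exact_mod_cast Nat.one_le_iff_ne_zero.mpr (Nat.mul_ne_zero (by omega) (by have := P.hL.2; omega))
  have hden : 0 < 12800 * (((P.d + 2) * P.L : ℕ) : ℝ) ^ 2 * (P.L : ℝ) := by positivity
  have hRs0 : 0 < Rs := inv_pos.mpr hden
  have hRs1 : 12800 * (((P.d + 2) * P.L : ℕ) : ℝ) ^ 2 * (P.L : ℝ) * Rs ≤ 1 := by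
    rw [hRsdef, mul_inv_cancel₀ hden.ne']
  have hC₃ : 0 ≤ C₃ := by rw [hC₃def]; positivity
  have h2ε : 0 ≤ 2 * ε := by positivity
  have h8 : 8 * (2 * ε) ≤ Rs := by rw [hRsdef]; linarith
  have hX₀' : ∀ b, w 1 b * ‖(A' - H (Dfun A')) b‖ < Rs := fun b => (hX₀ b).trans_lt (by linarith)
  -- §2: the identity
  have hid := chartD_fderiv_eq k D hDk hcollar hw hRs1 H Dfun h49 hA' hX₀' h𝔇 W
  -- §1b: the localised (72) in twisted form
  have h72 : ∀ (V : PBond P 0 → Matrix n n ℂ) (T : ℝ), 0 ≤ T → (∀ b, eE b * (w 1 b * ‖V b‖) ≤ T) → ∀ idx : BondIdx D,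
      eF idx * ‖(fderiv ℂ cL (A' - H (Dfun A'))) V idx - (fderiv ℂ cL 0) V idx‖ ≤ 2 * C₃ * κ * ε * T := by
    intro V T hT hV idx
    have hidx : 0 < eF idx := heF idx
    have hρ0 : 0 ≤ κ * T / eF idx := by positivity
    have hVloc : ∀ b : PBond P 0, (iterBlockOf (idx.1.1 : ℕ) b.src = idx.1.2.src ∨ iterBlockOf (idx.1.1 : ℕ) b.src = idx.1.2.tgt) →
        (iterBlockOf (idx.1.1 : ℕ) b.tgt = idx.1.2.src ∨ iterBlockOf (idx.1.1 : ℕ) b.tgt = idx.1.2.tgt) → w 1 b * ‖V b‖ ≤ κ * T / eF idx := by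
      intro b hs ht'
      have hb : 0 < eE b := heE b
      have h1 : eE b * (w 1 b * ‖V b‖) ≤ T := hV b
      have h2 : eF idx ≤ κ * eE b := hκ idx b hs ht'
      -- `w₁‖V b‖ ≤ T ∕ eE b ≤ κT ∕ eF idx`
      rw [le_div_iff₀ hidx]
      have h3 : w 1 b * ‖V b‖ * eF idx ≤ w 1 b * ‖V b‖ * (κ * eE b) :=
        mul_le_mul_of_nonneg_left h2 (mul_nonneg (levWeight_nonneg hw 1 b) (norm_nonneg _))
      calc w 1 b * ‖V b‖ * eF idx ≤ w 1 b * ‖V b‖ * (κ * eE b) := h3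
        _ = κ * (eE b * (w 1 b * ‖V b‖)) := by ring
        _ ≤ κ * T := mul_le_mul_of_nonneg_left h1 hκ0
    have h := norm_fderiv_chartC_apply_le_reads (𝔸 := Matrix n n ℂ) k D hDk hcollar hw hRs1 hRs0 (A' - H (Dfun A')) V h2ε h8 hρ0 hX₀ idx hVloc
    calc eF idx * ‖(fderiv ℂ cL (A' - H (Dfun A'))) V idx - (fderiv ℂ cL 0) V idx‖
        ≤ eF idx * (3840 * (((P.d + 2) * P.L : ℕ) : ℝ) * (P.L : ℝ) / Rs * (κ * T / eF idx) * (2 * ε)) :=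
          mul_le_mul_of_nonneg_left h hidx.le
      _ = 2 * C₃ * κ * ε * T := by rw [hC₃def]; field_simp
  -- the finite maximum `m`
  set m : ℝ := Finset.univ.sup' ⟨i, Finset.mem_univ i⟩ (fun j : BondIdx D => eF j * ‖𝔇 W j‖) with hmdef
  have hle_m : ∀ j, eF j * ‖𝔇 W j‖ ≤ m := fun j => Finset.le_sup' (fun j : BondIdx D => eF j * ‖𝔇 W j‖) (Finset.mem_univ j)
  have hm0 : 0 ≤ m := (mul_nonneg (heF i).le (norm_nonneg _)).trans (hle_m i)
  -- each index: `eF·‖𝔇W‖ ≤ 2C₃κεt + 2C₃κεB_e·m`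
  have hHm : ∀ b, eE b * (w 1 b * ‖H (𝔇 W) b‖) ≤ Be * m := hHe (𝔇 W) m hm0 hle_m
  have hstep : ∀ j, eF j * ‖𝔇 W j‖ ≤ 2 * C₃ * κ * ε * t + 2 * C₃ * κ * ε * (Be * m) := by
    intro j
    have hj : 𝔇 W j = ((fderiv ℂ cL (A' - H (Dfun A'))) W j - (fderiv ℂ cL 0) W j) -
        ((fderiv ℂ cL (A' - H (Dfun A'))) (H (𝔇 W)) j - (fderiv ℂ cL 0) (H (𝔇 W)) j) := by
      have := congrArg (fun X : BondIdx D → Matrix n n ℂ => X j) hid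
      simp only [Pi.sub_apply, map_sub] at this
      rw [this]; abel
    rw [hj]
    calc eF j * ‖((fderiv ℂ cL (A' - H (Dfun A'))) W j - (fderiv ℂ cL 0) W j) -
          ((fderiv ℂ cL (A' - H (Dfun A'))) (H (𝔇 W)) j - (fderiv ℂ cL 0) (H (𝔇 W)) j)‖
        ≤ eF j * (‖(fderiv ℂ cL (A' - H (Dfun A'))) W j - (fderiv ℂ cL 0) W j‖ +
            ‖(fderiv ℂ cL (A' - H (Dfun A'))) (H (𝔇 W)) j - (fderiv ℂ cL 0) (H (𝔇 W)) j‖) :=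
          mul_le_mul_of_nonneg_left (norm_sub_le _ _) (heF j).le
      _ ≤ 2 * C₃ * κ * ε * t + 2 * C₃ * κ * ε * (Be * m) := by
          rw [mul_add]
          exact add_le_add (h72 W t ht hW j) (h72 (H (𝔇 W)) (Be * m) (by positivity) hHm j)
  -- (71): `m ≤ 2C₃κεt + ½m`, hence `m ≤ 4C₃κεt`
  have hm_le : m ≤ 2 * C₃ * κ * ε * t + 2 * C₃ * κ * ε * (Be * m) := Finset.sup'_le _ _ fun j _ => hstep j
  have hq : 2 * C₃ * κ * ε * Be ≤ 1 / 2 := by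
    have : 4 * C₃ * κ * Be * ε ≤ 1 := hsmall
    nlinarith
  have hm_fin : m ≤ 4 * C₃ * κ * ε * t := by
    have h1 : 2 * C₃ * κ * ε * (Be * m) ≤ m / 2 := by
      have := mul_le_mul_of_nonneg_right hq hm0
      linarith [this]
    nlinarith [hm_le, h1, mul_nonneg (mul_nonneg (mul_nonneg hC₃ hκ0) hε.le) ht]
  exact (hle_m i).trans hm_fin

end Twisted

/-! ## §4  Exponential twists: the kernel-decay reading of (73) -/

section Decay

variable {n : Type*} [Fintype n] [DecidableEq n] [Nonempty n]

omit [Nonempty n] in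
/-- **A KERNEL-DECAY LETTER FOR `H` GIVES THE TWISTED (46) LETTER FOR EVERY EXPONENTIAL TWIST OF SMALLER RATE** — the step «|(I + ℜ)⁻¹(c, c′)| ≤ … e^{−½δ₀d(c₋,c′₋)}
… which follows from Lemma 2.1 [3]» read for the input `H`: if `w₁(b)‖HX(b)‖ ≤ B₀Σ_c e^{−δ₀d(b,c)}‖X(c)‖` (the matrix form of P2's `HDecayLetterD`, first row, over a
bipartite distance `d = dBI`), `dE`, `dF` are «distances to a fixed block `y`» on the fine bonds ∕ index bonds with the triangle inequality `dE(b) ≤ d(b,c) + dF(c)`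
([3] (2.54)), and `Σ_c e^{−(δ₀−δ)d(b,c)} ≤ c₁` at every fine bond (the scale sum `c₁` of [3] Lemma 2.1, print's `d·c₁(½)` at `δ = ½δ₀`), then for data with
`e^{δ·dF(c)}‖X(c)‖ ≤ t`: `e^{δ·dE(b)}·w₁(b)‖HX(b)‖ ≤ B₀c₁·t`. Finite-sum bookkeeping. [cite: Balaban1985Variational, (71) p.289; Balaban1984PropagatorsII, Lemma 2.1 p.232, (2.54) p.233] -/
theorem twistedLetter_of_kernelDecay {D : Domains P} {w : ℕ → PBond P 0 → ℝ}
    (H : (BondIdx D → Matrix n n ℂ) →ₗ[ℂ] (PBond P 0 → Matrix n n ℂ)) {B₀ δ₀ δ : ℝ} (hB₀ : 0 ≤ B₀) (hδ : 0 ≤ δ)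
    (dBI : PBond P 0 → BondIdx D → ℝ)
    (hHd : ∀ (X : BondIdx D → Matrix n n ℂ) (b : PBond P 0), w 1 b * ‖H X b‖ ≤ B₀ * ∑ c, Real.exp (-(δ₀ * dBI b c)) * ‖X c‖)
    (dE : PBond P 0 → ℝ) (dF : BondIdx D → ℝ) (htri : ∀ b c, dE b ≤ dBI b c + dF c)
    {c₁ : ℝ} (hrow : ∀ b, ∑ c, Real.exp (-((δ₀ - δ) * dBI b c)) ≤ c₁)
    (X : BondIdx D → Matrix n n ℂ) (t : ℝ) (ht : 0 ≤ t) (hX : ∀ c, Real.exp (δ * dF c) * ‖X c‖ ≤ t) (b : PBond P 0) :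
    Real.exp (δ * dE b) * (w 1 b * ‖H X b‖) ≤ B₀ * c₁ * t := by
  have hterm : ∀ c, Real.exp (δ * dE b) * (Real.exp (-(δ₀ * dBI b c)) * ‖X c‖) ≤ Real.exp (-((δ₀ - δ) * dBI b c)) * t := by
    intro c
    have h1 : Real.exp (δ * dE b) * (Real.exp (-(δ₀ * dBI b c)) * ‖X c‖) =
        Real.exp (δ * dE b - δ₀ * dBI b c - δ * dF c) * (Real.exp (δ * dF c) * ‖X c‖) := by
      rw [← mul_assoc, ← Real.exp_add, ← mul_assoc, ← Real.exp_add]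
      congr 1; ring_nf
    rw [h1]
    have h2 : Real.exp (δ * dE b - δ₀ * dBI b c - δ * dF c) ≤ Real.exp (-((δ₀ - δ) * dBI b c)) := by
      apply Real.exp_le_exp.mpr
      have := mul_le_mul_of_nonneg_left (htri b c) hδ
      nlinarith
    exact mul_le_mul h2 (hX c) (by positivity) (Real.exp_pos _).le
  calc Real.exp (δ * dE b) * (w 1 b * ‖H X b‖)
      ≤ Real.exp (δ * dE b) * (B₀ * ∑ c, Real.exp (-(δ₀ * dBI b c)) * ‖X c‖) :=
        mul_le_mul_of_nonneg_left (hHd X b) (Real.exp_pos _).le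
    _ = B₀ * ∑ c, Real.exp (δ * dE b) * (Real.exp (-(δ₀ * dBI b c)) * ‖X c‖) := by
        rw [Finset.mul_sum, Finset.mul_sum, Finset.mul_sum]
        refine Finset.sum_congr rfl fun c _ => ?_
        ring
    _ ≤ B₀ * ∑ c, Real.exp (-((δ₀ - δ) * dBI b c)) * t :=
        mul_le_mul_of_nonneg_left (Finset.sum_le_sum fun c _ => hterm c) hB₀
    _ = B₀ * ((∑ c, Real.exp (-((δ₀ - δ) * dBI b c))) * t) := by rw [Finset.sum_mul]
    _ ≤ B₀ * (c₁ * t) := mul_le_mul_of_nonneg_left (mul_le_mul_of_nonneg_right (hrow b) ht) hB₀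
    _ = B₀ * c₁ * t := by ring

/-- ★★★ **[15] (73) IN PRINT's SHAPE — EXPONENTIAL DECAY OF THE FUNCTIONAL DERIVATIVE OF `D` AWAY FROM THE SUPPORT OF THE DIRECTION** «|𝔇(A′; c, b)| ≤
O(1)C₃ε₃ … e^{−½δ₀d(c₋,y)}, b ∈ Bʲ(y), y ∈ Λ_j».  Data as in `chartD_fderiv_twisted_le`, with: a bipartite distance `d(b,c)` (fine bond, index bond) carrying the
KERNEL-DECAY letter of `H` at rate `δ₀` (DISPLAYED) and the row sum `Σ_c e^{−(δ₀−δ)d(b,c)} ≤ c₁` (`0 ≤ δ`); «distances to the block `y`» `dE` (fine bonds), `dF`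
(index bonds) with the triangle inequality `dE(b) ≤ d(b,c) + dF(c)` and READ-LOCALITY `dF(j,c) ≤ dE(b) + r₀` for `b` read by `(j,c)` (the read set of an index lies
within `r₀` of it); window `4C₃e^{δr₀}B₀c₁ε ≤ 1`.  Then for every direction `W` SUPPORTED WHERE `dE ≤ r` with plain weighted size `w₁(b)‖W b‖ ≤ t`:
**`‖𝔇W (j,c)‖ ≤ 4C₃e^{δr₀}ε · e^{δr} · e^{−δ·dF(j,c)} · t`** at every index — the twists `e^{δ·dE}`, `e^{δ·dF}` in §3. [cite: Balaban1985Variational, (70)-(73) p.289, Prop. 3 p.289; Balaban1984PropagatorsII, Lemma 2.1 p.232, (2.54) p.233] -/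
theorem chartD_fderiv_decay (k : ℕ) (D : Domains P) (hDk : D.k = k)
    (hcollar : ∀ (i : ℕ) (e : PBond P (i + 1)), D.LamBond (i + 1) e → ∀ z : Site P i, (blockOf z = e.src ∨ blockOf z = e.tgt) → z ∈ D.Om i)
    {w : ℕ → PBond P 0 → ℝ} (hw : IsLevWeight P k D w)
    (H : (BondIdx D → Matrix n n ℂ) →ₗ[ℂ] (PBond P 0 → Matrix n n ℂ)) {ε : ℝ} (hε : 0 < ε)
    (h16 : 16 * ε ≤ (12800 * (((P.d + 2) * P.L : ℕ) : ℝ) ^ 2 * (P.L : ℝ))⁻¹)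
    (Dfun : (PBond P 0 → Matrix n n ℂ) → (BondIdx D → Matrix n n ℂ))
    (h49 : ∀ A : PBond P 0 → Matrix n n ℂ, (∀ b, w 1 b * ‖A b‖ < ε) →
      chartLog (((P.L : ℝ)⁻¹) ^ k) D (A - H (Dfun A)) -
          (fderiv ℂ (chartLog (((P.L : ℝ)⁻¹) ^ k) D : (PBond P 0 → Matrix n n ℂ) → BondIdx D → Matrix n n ℂ) 0) (A - H (Dfun A)) = Dfun A)
    {A' : PBond P 0 → Matrix n n ℂ} (hA' : ∀ b, w 1 b * ‖A' b‖ < ε) (hX₀ : ∀ b, w 1 b * ‖(A' - H (Dfun A')) b‖ ≤ 2 * ε)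
    {𝔇 : (PBond P 0 → Matrix n n ℂ) →L[ℂ] (BondIdx D → Matrix n n ℂ)} (h𝔇 : HasFDerivAt Dfun 𝔇 A')
    -- the kernel-decay letter of `H` over a bipartite distance, and its row sum at the reduced rate
    (dBI : PBond P 0 → BondIdx D → ℝ) {B₀ δ₀ δ c₁ : ℝ} (hB₀ : 0 ≤ B₀) (hδ : 0 ≤ δ) (hc₁ : 0 ≤ c₁)
    (hHd : ∀ (X : BondIdx D → Matrix n n ℂ) (b : PBond P 0), w 1 b * ‖H X b‖ ≤ B₀ * ∑ c, Real.exp (-(δ₀ * dBI b c)) * ‖X c‖)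
    (hrow : ∀ b, ∑ c, Real.exp (-((δ₀ - δ) * dBI b c)) ≤ c₁)
    -- distances to the block `y`: triangle inequality and read-locality
    (dE : PBond P 0 → ℝ) (dF : BondIdx D → ℝ) (htri : ∀ b c, dE b ≤ dBI b c + dF c) {r₀ : ℝ}
    (hread : ∀ (idx : BondIdx D) (b : PBond P 0),
      (iterBlockOf (idx.1.1 : ℕ) b.src = idx.1.2.src ∨ iterBlockOf (idx.1.1 : ℕ) b.src = idx.1.2.tgt) →
      (iterBlockOf (idx.1.1 : ℕ) b.tgt = idx.1.2.src ∨ iterBlockOf (idx.1.1 : ℕ) b.tgt = idx.1.2.tgt) → dF idx ≤ dE b + r₀)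
    (hsmall : 4 * (3840 * (((P.d + 2) * P.L : ℕ) : ℝ) * (P.L : ℝ) / (12800 * (((P.d + 2) * P.L : ℕ) : ℝ) ^ 2 * (P.L : ℝ))⁻¹) *
      Real.exp (δ * r₀) * (B₀ * c₁) * ε ≤ 1)
    -- a direction supported within `r` of `y`
    (W : PBond P 0 → Matrix n n ℂ) {r t : ℝ} (ht : 0 ≤ t) (hW : ∀ b, w 1 b * ‖W b‖ ≤ t) (hWsupp : ∀ b, r < dE b → W b = 0)
    (i : BondIdx D) :
    ‖𝔇 W i‖ ≤ 4 * (3840 * (((P.d + 2) * P.L : ℕ) : ℝ) * (P.L : ℝ) / (12800 * (((P.d + 2) * P.L : ℕ) : ℝ) ^ 2 * (P.L : ℝ))⁻¹) *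
      Real.exp (δ * r₀) * ε * (Real.exp (δ * r) * t) * Real.exp (-(δ * dF i)) := by
  -- the exponential twists
  have heE : ∀ b, 0 < Real.exp (δ * dE b) := fun b => Real.exp_pos _
  have heF : ∀ c : BondIdx D, 0 < Real.exp (δ * dF c) := fun c => Real.exp_pos _
  have hκ : ∀ (idx : BondIdx D) (b : PBond P 0),
      (iterBlockOf (idx.1.1 : ℕ) b.src = idx.1.2.src ∨ iterBlockOf (idx.1.1 : ℕ) b.src = idx.1.2.tgt) →
      (iterBlockOf (idx.1.1 : ℕ) b.tgt = idx.1.2.src ∨ iterBlockOf (idx.1.1 : ℕ) b.tgt = idx.1.2.tgt) →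
      Real.exp (δ * dF idx) ≤ Real.exp (δ * r₀) * Real.exp (δ * dE b) := by
    intro idx b hs ht'
    rw [← Real.exp_add]
    exact Real.exp_le_exp.mpr (by nlinarith [hread idx b hs ht'])
  have hHe := twistedLetter_of_kernelDecay H hB₀ hδ dBI hHd dE dF htri hrow
  -- the twisted size of the supported direction
  have hWe : ∀ b, Real.exp (δ * dE b) * (w 1 b * ‖W b‖) ≤ Real.exp (δ * r) * t := by
    intro b
    by_cases hb : r < dE b
    · rw [hWsupp b hb, norm_zero, mul_zero, mul_zero]; positivity
    · exact mul_le_mul (Real.exp_le_exp.mpr (by nlinarith [not_lt.mp hb])) (hW b)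
        (mul_nonneg (levWeight_nonneg hw 1 b) (norm_nonneg _)) (Real.exp_pos _).le
  have h := chartD_fderiv_twisted_le k D hDk hcollar hw H hε h16 Dfun h49 hA' hX₀ h𝔇 (fun b => Real.exp (δ * dE b)) (fun c => Real.exp (δ * dF c))
    heE heF (Real.exp_pos (δ * r₀)).le hκ (mul_nonneg hB₀ hc₁) hHe hsmall W (Real.exp (δ * r) * t) (by positivity) hWe i
  -- divide by the twist `e^{δ·dF(i)}`
  have hi : 0 < Real.exp (δ * dF i) := Real.exp_pos _
  rw [Real.exp_neg, ← div_eq_mul_inv, le_div_iff₀ hi, mul_comm]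
  exact h

end Decay

/-! ## §5  Packaged with generation 3's selector; the windows are inhabited (A6) -/

section Packaged

variable {n : Type*} [Fintype n] [DecidableEq n] [Nonempty n]

/-- ★★★ **[15] PROPOSITION 3 FOR THE TRUE MULTI-LEVEL (0.4)-CONSTRAINT WITH (73) IN BOTH FORMS** — generation 3's `N07ChartDDerivative.exists_chartD_hasFDerivAt` (the chart
map `D(·)`, ℂ-differentiable on the weighted `ε`-ball, with (55), (49), (48), a Fréchet derivative and the norm-level (73) `‖𝔇W i‖ ≤ 4C₃ε·t`) AND, for every read-compatible
pair of twists `eE`, `eF` under which `H` carries the twisted (46) letter `B_e` (DISPLAYED) and `4C₃κB_eε ≤ 1`, the twisted (73) `eF(i)·‖𝔇W i‖ ≤ 4C₃κε·sup_b eE(b)w₁(b)‖W b‖`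
(§3; the chart point's size `≤ 2ε` is (57) = `N07ChartDOfRecord.size_chartA_le` with (55) and `18C₂B₀ε ≤ 1`). [cite: Balaban1985Variational, (47)-(57) pp.285-287, (70)-(73) p.289, Prop. 3 p.289] -/
theorem exists_chartD_hasFDerivAt_twisted (k : ℕ) {R' M : ℕ} (hR'L : 2 * P.L ≤ R') (hM : 1 ≤ M) (D : Domains P) (hDk : D.k = k) (hAdm : Adm22 D R' M)
    {w : ℕ → PBond P 0 → ℝ} (hw : IsLevWeight P k D w)
    (H : (BondIdx D → Matrix n n ℂ) →ₗ[ℂ] (PBond P 0 → Matrix n n ℂ))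
    (hHinv : ∀ X, (fderiv ℂ (chartLog (((P.L : ℝ)⁻¹) ^ k) D : (PBond P 0 → Matrix n n ℂ) → BondIdx D → Matrix n n ℂ) 0) (H X) = X)
    {B₀ : ℝ} (hB₀ : 0 ≤ B₀)
    (hHB : ∀ (X : BondIdx D → Matrix n n ℂ) (t : ℝ), 0 ≤ t → (∀ i, ‖X i‖ ≤ t) → ∀ b, w 1 b * ‖H X b‖ ≤ B₀ * t)
    {ε : ℝ} (hε : 0 < ε)
    (h18 : 18 * (960 * (((P.d + 2) * P.L : ℕ) : ℝ) * (P.L : ℝ) / (12800 * (((P.d + 2) * P.L : ℕ) : ℝ) ^ 2 * (P.L : ℝ))⁻¹) * B₀ * ε ≤ 1)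
    (h2 : 64 * ε ≤ (12800 * (((P.d + 2) * P.L : ℕ) : ℝ) ^ 2 * (P.L : ℝ))⁻¹)
    (eE : PBond P 0 → ℝ) (eF : BondIdx D → ℝ) (heE : ∀ b, 0 < eE b) (heF : ∀ i, 0 < eF i) {κ : ℝ} (hκ0 : 0 ≤ κ)
    (hκ : ∀ (idx : BondIdx D) (b : PBond P 0),
      (iterBlockOf (idx.1.1 : ℕ) b.src = idx.1.2.src ∨ iterBlockOf (idx.1.1 : ℕ) b.src = idx.1.2.tgt) →
      (iterBlockOf (idx.1.1 : ℕ) b.tgt = idx.1.2.src ∨ iterBlockOf (idx.1.1 : ℕ) b.tgt = idx.1.2.tgt) → eF idx ≤ κ * eE b)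
    {Be : ℝ} (hBe : 0 ≤ Be)
    (hHe : ∀ (X : BondIdx D → Matrix n n ℂ) (t : ℝ), 0 ≤ t → (∀ i, eF i * ‖X i‖ ≤ t) → ∀ b, eE b * (w 1 b * ‖H X b‖) ≤ Be * t)
    (hsmall : 4 * (3840 * (((P.d + 2) * P.L : ℕ) : ℝ) * (P.L : ℝ) / (12800 * (((P.d + 2) * P.L : ℕ) : ℝ) ^ 2 * (P.L : ℝ))⁻¹) * κ * Be * ε ≤ 1) :
    let η : ℝ := ((P.L : ℝ)⁻¹) ^ k
    let Rs : ℝ := (12800 * (((P.d + 2) * P.L : ℕ) : ℝ) ^ 2 * (P.L : ℝ))⁻¹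
    let C₂ : ℝ := 960 * (((P.d + 2) * P.L : ℕ) : ℝ) * (P.L : ℝ) / Rs
    let C₃ : ℝ := 3840 * (((P.d + 2) * P.L : ℕ) : ℝ) * (P.L : ℝ) / Rs
    let Qlin := (fderiv ℂ (chartLog η D : (PBond P 0 → Matrix n n ℂ) → BondIdx D → Matrix n n ℂ) 0)
    ∃ Dfun : (PBond P 0 → Matrix n n ℂ) → (BondIdx D → Matrix n n ℂ),
      DifferentiableOn ℂ Dfun {A' : PBond P 0 → Matrix n n ℂ | ∀ b, w 1 b * ‖A' b‖ < ε} ∧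
      ∀ A' : PBond P 0 → Matrix n n ℂ, (∀ b, w 1 b * ‖A' b‖ < ε) →
        (∀ (ρ : ℝ), 0 ≤ ρ → (∀ b, w 1 b * ‖A' b‖ ≤ ρ) → ∀ i, ‖Dfun A' i‖ ≤ 4 * C₂ * ρ ^ 2) ∧
        chartLog η D (A' - H (Dfun A')) - Qlin (A' - H (Dfun A')) = Dfun A' ∧
        chartLog η D (A' - H (Dfun A')) = Qlin A' ∧
        ∃ 𝔇 : (PBond P 0 → Matrix n n ℂ) →L[ℂ] (BondIdx D → Matrix n n ℂ), HasFDerivAt Dfun 𝔇 A' ∧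
          (∀ (W : PBond P 0 → Matrix n n ℂ) (t : ℝ), 0 ≤ t → (∀ b, w 1 b * ‖W b‖ ≤ t) → ∀ i, ‖𝔇 W i‖ ≤ 4 * C₃ * ε * t) ∧
          ∀ (W : PBond P 0 → Matrix n n ℂ) (t : ℝ), 0 ≤ t → (∀ b, eE b * (w 1 b * ‖W b‖) ≤ t) → ∀ i, eF i * ‖𝔇 W i‖ ≤ 4 * C₃ * κ * ε * t := by
  intro η Rs C₂ C₃ Qlin
  have hL0 : (0 : ℝ) < P.L := by exact_mod_cast P.L_pos
  have hℓ1 : (1 : ℝ) ≤ (((P.d + 2) * P.L : ℕ) : ℝ) := by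
    exact_mod_cast Nat.one_le_iff_ne_zero.mpr (Nat.mul_ne_zero (by omega) (by have := P.hL.2; omega))
  have hden : 0 < 12800 * (((P.d + 2) * P.L : ℕ) : ℝ) ^ 2 * (P.L : ℝ) := by positivity
  have hRs0 : 0 < Rs := inv_pos.mpr hden
  have hC₂ : 0 ≤ C₂ := by show 0 ≤ 960 * (((P.d + 2) * P.L : ℕ) : ℝ) * (P.L : ℝ) / Rs; positivity
  have hwpos : ∀ b, 0 < w 1 b := fun b => by rw [hw 1 b, pow_one]; positivity
  have hRM : 2 * P.L ≤ R' * M + 1 := by have : R' ≤ R' * M := Nat.le_mul_of_pos_right R' hM; omega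
  have hcollar := collar_of_adm22 D hAdm hRM
  obtain ⟨Dfun, hdiff, hDfun⟩ := exists_chartD_hasFDerivAt k hR'L hM D hDk hAdm hw H hHinv hB₀ hHB hε h18 h2
  refine ⟨Dfun, hdiff, fun A' hA' => ?_⟩
  obtain ⟨h55, h49, h48, 𝔇, h𝔇, h73⟩ := hDfun A' hA'
  refine ⟨h55, h49, h48, 𝔇, h𝔇, h73, fun W t ht hW i => ?_⟩
  -- (57): the chart point has weighted size `≤ ε + 4C₂B₀ε² ≤ 2ε`
  have h4 : 4 * C₂ * B₀ * ε ≤ 1 := by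
    have h18' : 18 * C₂ * B₀ * ε ≤ 1 := h18
    nlinarith [mul_nonneg (mul_nonneg hC₂ hB₀) hε.le]
  have hX₀ : ∀ b, w 1 b * ‖(A' - H (Dfun A')) b‖ ≤ 2 * ε := fun b => by
    have h := size_chartA_le hwpos H hC₂ hB₀ hHB (fun b => (hA' b).le) (h55 ε hε.le fun b => (hA' b).le) b
    have : B₀ * (4 * C₂ * ε ^ 2) ≤ ε := by nlinarith [mul_nonneg (mul_nonneg hC₂ hB₀) hε.le]
    linarith
  have h16 : 16 * ε ≤ Rs := by show 16 * ε ≤ (12800 * (((P.d + 2) * P.L : ℕ) : ℝ) ^ 2 * (P.L : ℝ))⁻¹; linarith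
  exact chartD_fderiv_twisted_le k D hDk hcollar hw H hε h16 Dfun (fun A hA => (hDfun A hA).2.1) hA' hX₀ h𝔇 eE eF heE heF hκ0 hκ hBe hHe hsmall W t ht hW i

omit [Nonempty n] in
/-- **CONSISTENCY OF THE BINDER BLOCK (A6, DEGENERATE WITNESS): AT THE TRIVIAL TWIST THE DISPLAYED HYPOTHESES ARE GENERATION 3's** — with `eE ≡ eF ≡ 1`, `κ = 1` the
read-compatibility is trivial and the twisted (46) letter with `B_e = B₀` IS the plain (46) letter `hHB`; §3 then returns the norm-level (73) `‖𝔇W i‖ ≤ 4C₃ε·t` (g3's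
constant).  A witness with a genuinely decaying twist at the record's `H` is the missing (non-degenerate) A6 — it IS the kernel-decay letter of `H`, displayed.
[cite: Balaban1985Variational, (46) p.285, (73) p.289] -/
theorem twistedLetter_one_of_supLetter {D : Domains P} {w : ℕ → PBond P 0 → ℝ}
    (H : (BondIdx D → Matrix n n ℂ) →ₗ[ℂ] (PBond P 0 → Matrix n n ℂ)) {B₀ : ℝ}
    (hHB : ∀ (X : BondIdx D → Matrix n n ℂ) (t : ℝ), 0 ≤ t → (∀ i, ‖X i‖ ≤ t) → ∀ b, w 1 b * ‖H X b‖ ≤ B₀ * t) :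
    (∀ (idx : BondIdx D) (b : PBond P 0),
      (iterBlockOf (idx.1.1 : ℕ) b.src = idx.1.2.src ∨ iterBlockOf (idx.1.1 : ℕ) b.src = idx.1.2.tgt) →
      (iterBlockOf (idx.1.1 : ℕ) b.tgt = idx.1.2.src ∨ iterBlockOf (idx.1.1 : ℕ) b.tgt = idx.1.2.tgt) →
        (fun _ : BondIdx D => (1 : ℝ)) idx ≤ 1 * (fun _ : PBond P 0 => (1 : ℝ)) b) ∧
    ∀ (X : BondIdx D → Matrix n n ℂ) (t : ℝ), 0 ≤ t → (∀ i, (fun _ : BondIdx D => (1 : ℝ)) i * ‖X i‖ ≤ t) →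
      ∀ b, (fun _ : PBond P 0 => (1 : ℝ)) b * (w 1 b * ‖H X b‖) ≤ B₀ * t := by
  refine ⟨fun _ _ _ _ => by norm_num, fun X t ht hX b => ?_⟩
  rw [one_mul]
  exact hHB X t ht (fun i => by simpa using hX i) b

/-- **THE JOINT `ε`-WINDOW IS INHABITED** (A6): for `C₂, C₃, B₀, κ, B_e ≥ 0` and `R > 0`, some `ε > 0` has `18C₂B₀ε ≤ 1`, `64ε ≤ R` and `4C₃κB_eε ≤ 1` («ε₃ sufficiently
small», p.289). [cite: Balaban1985Variational, Prop. 3 p.289] -/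
theorem exists_eps_twisted {C₂ C₃ B₀ κ Be R : ℝ} (hC₂ : 0 ≤ C₂) (hC₃ : 0 ≤ C₃) (hB₀ : 0 ≤ B₀) (hκ : 0 ≤ κ) (hBe : 0 ≤ Be) (hR : 0 < R) :
    ∃ ε : ℝ, 0 < ε ∧ 18 * C₂ * B₀ * ε ≤ 1 ∧ 64 * ε ≤ R ∧ 4 * C₃ * κ * Be * ε ≤ 1 := by
  refine ⟨min (R / 64) (1 / (18 * C₂ * B₀ + 4 * C₃ * κ * Be + 1)), lt_min (by positivity) (by positivity), ?_, ?_, ?_⟩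
  · have h1 : min (R / 64) (1 / (18 * C₂ * B₀ + 4 * C₃ * κ * Be + 1)) ≤ 1 / (18 * C₂ * B₀ + 4 * C₃ * κ * Be + 1) := min_le_right _ _
    have h2 : 18 * C₂ * B₀ * (1 / (18 * C₂ * B₀ + 4 * C₃ * κ * Be + 1)) ≤ 1 := by
      rw [mul_one_div, div_le_one (by positivity)]; nlinarith [mul_nonneg (mul_nonneg hC₃ hκ) hBe]
    exact le_trans (mul_le_mul_of_nonneg_left h1 (by positivity)) h2
  · have : min (R / 64) (1 / (18 * C₂ * B₀ + 4 * C₃ * κ * Be + 1)) ≤ R / 64 := min_le_left _ _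
    linarith
  · have h1 : min (R / 64) (1 / (18 * C₂ * B₀ + 4 * C₃ * κ * Be + 1)) ≤ 1 / (18 * C₂ * B₀ + 4 * C₃ * κ * Be + 1) := min_le_right _ _
    have h2 : 4 * C₃ * κ * Be * (1 / (18 * C₂ * B₀ + 4 * C₃ * κ * Be + 1)) ≤ 1 := by
      rw [mul_one_div, div_le_one (by positivity)]; nlinarith [mul_nonneg hC₂ hB₀]
    exact le_trans (mul_le_mul_of_nonneg_left h1 (by positivity)) h2

end Packaged

end Summit.QuantumFields.YangMills.BalabanUVNodes.N07ChartDDecay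

end
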